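import Summits.BirchSwinnertonDyer.BirchSwinnertonDyer.Theorems.AlignedTransportAtTwoMainConjectureTransportAlignedAtTwoNegTwistSymbol
import Literature.NumberTheory.EllipticCurves.PAdicLFunctionQuadraticTwistCongruenceAtTwoSharedPrimesProofs
import HarnessLib

/-!
# Route `AlignedTransportAtTwo`, crux C1 `MainConjectureTransportAlignedAtTwo` (stmt-BirchSwinnertonDyer-22296), line `birth` — NEGATIVE twists,
# symbol level at a tame level SHARING primes with `N` (core MULTIPLICATIVE at primes of `d`): the extended rhombic congruence RELATIVE TO THE
# CUSP `1/g` (`[x]⁺ − [x]⁻ ≡ [1/g]⁺ − [1/g]⁻ (mod ℤ)` for `gcd(den x, N) = g`, `gcd(den x, N/g) = 1`), the odd Birch lemma without `(d, N_E) = 1`,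
# and the rhombic shortcut at such a level

HONEST FRAMING (cell `bsd-f1-sign2`, lead seat `bsd-line-att-p1` g7). BSD is NOT proved; C1 is NOT closed. THEOREMS ONLY; nothing asserted;
`--supports stmt-BirchSwinnertonDyer-22296 --as helper`. Companion of `…NegTwistSymbol.lean` (which needs `(m, N) = 1`: every tame cusp is then
equivalent to `0`). When the core `E` is MULTIPLICATIVE at a prime `ℓ ∣ d` (`ℓ ∥ N`), the tame cusps `x + b/m` (`b` a unit mod `m = |d|`) have
denominator `den(x)·m`, meeting `N` in `g = gcd(m, N)` with `gcd(den, N/g) = 1`, so they all lie in the class of `1/g` (tree: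
`modularSymbol_sub_inv_gcd_mem_periodLattice`, Manin / Cremona §2.2) and the rhombic parity lemma gives `[x + b/m]⁻ = [x + b/m]⁺ − κ_g − k_b` with ONE
constant `κ_g = [1/g]⁺ − [1/g]⁻`; `Σ_b χ(b) = 0` kills it as before.

* §1 `exists_int_ratPlusSymbol_sub_ratMinusSymbol_eq_inv_of_isRhombic` — the relative congruence at the cusp `1/g`.
* §2 `exists_ratPlusSymbol_twist_eq_sum_odd_and_sq_sqfreeAt` — odd Birch for `(f_W, f_A)`, `d < 0`, `E` good OR multiplicative at the primes of
  `d`, with `c²·|d|·(Ω⁺_{f_A})² = (Ω⁻_{f_W})²`.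
* §3 `den_add_div_eq`, `exists_int_ratPlusSymbol_twist_eq_sum_plus_add_sqfreeAt` — the shortcut at a tame level with `ℓ ∥ N` at the primes of `m`.

References: [Manin1972] Prop. 1.4, Thm. 1.6; [CremonaAlgorithms1997] §2.2, §2.8; [MazurTateTeitelbaum1986Invent] §I.8; [Shimura1971] Prop. 3.64.
-/

set_option autoImplicit false
set_option linter.dupNamespace false

noncomputable section

open scoped Classical MatrixGroups ModularForm NumberTheorySymbols

open CongruenceSubgroup WeierstrassCurve NumberField IsDedekindDomain Rat.HeightOneSpectrum
open Literature.NumberTheory.EllipticCurves Literature.NumberTheory.EllipticCurves.ModularForms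
open Summit.BirchSwinnertonDyer.Rank1Residual.F1Sign2
open Summit.BirchSwinnertonDyer.BirchSwinnertonDyer.Theorems.AlignedTransportAtTwoNegTwistSymbol

namespace Summit.BirchSwinnertonDyer.BirchSwinnertonDyer.Theorems.AlignedTransportAtTwoNegTwistSymbolShared

/-! ## §1 The rhombic congruence relative to the cusp `1/g` -/

section Rhombic

variable {N : ℕ} [NeZero N] (f : CuspForm (Gamma0 N) 2)

/-- **The extended rhombic symbol congruence relative to `1/g`.** For a normalised newform `f ∈ S₂(Γ₀(N))` with rational coefficients and RHOMBIC
period lattice, and `x ∈ ℚ` with `gcd(den x, N/g) = 1` where `g = gcd(den x, N)`: `[x]⁺_f − [x]⁻_f = ([1/g]⁺_f − [1/g]⁻_f) + k`, `k ∈ ℤ`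
(`{∞, x} − {∞, 1/g} ∈ Λ_f`, `modularSymbol_sub_inv_gcd_mem_periodLattice`; rhombic parity `re_div_sub_im_div_of_rhombic`).
[cite: Manin1972, Prop. 1.4 and Thm. 1.6] [cite: CremonaAlgorithms1997, §2.2 and §2.8] -/
theorem exists_int_ratPlusSymbol_sub_ratMinusSymbol_eq_inv_of_isRhombic (hf : IsNewform0 f) (hQ : coeffField f = ⊥)
    (hrh : IsRhombic f) (x : ℚ) (hx : Nat.Coprime x.den (N / Nat.gcd x.den N)) :
    ∃ k : ℤ, ratPlusSymbol f x - ratMinusSymbol f x =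
      (ratPlusSymbol f (1 / ((Nat.gcd x.den N : ℕ) : ℚ)) - ratMinusSymbol f (1 / ((Nat.gcd x.den N : ℕ) : ℚ))) + k := by
  have hreal : ∀ n, (cuspCoeff f n).im = 0 := cuspCoeff_im_eq_zero_of_coeffField_eq_bot hQ
  have hz := modularSymbol_sub_inv_gcd_mem_periodLattice f hx
  set y : ℚ := 1 / ((Nat.gcd x.den N : ℕ) : ℚ) with hy
  obtain ⟨hΩp, hre⟩ := plusPeriod_pos_and_realPeriods_eq isZLattice_periodLattice_holds hf hQ
  have hΩm : 0 < minusPeriod f := IsNewform0.minusPeriod_pos_holds hf hQ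
  have him : imagPeriods f = AddSubgroup.zmultiples (minusPeriod f / 2) := by
    rcases minusPeriod_eq_zero_or f with h0 | ⟨_, h⟩
    · exact absurd h0 hΩm.ne'
    · exact h
  have hconj : ∀ z ∈ periodLattice f, (starRingEnd ℂ) z ∈ periodLattice f :=
    fun z hz' ↦ conj_mem_periodLattice_holds hf hQ hz'
  obtain ⟨k, hk⟩ := re_div_sub_im_div_of_rhombic (periodLattice f) hconj hΩp hΩm hre him hrh _ hz
  refine ⟨k, ?_⟩
  have hPx := ratCast_ratPlusSymbol_holds hf hQ x
  have hPy := ratCast_ratPlusSymbol_holds hf hQ y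
  have hMx := ratCast_ratMinusSymbol f hf hQ x
  have hMy := ratCast_ratMinusSymbol f hf hQ y
  have eP : ∀ r : ℚ, normalizedPlusSymbol f r = (modularSymbol f r).re / plusPeriod f := fun r ↦ by
    rw [normalizedPlusSymbol, plusSymbol_eq_re_holds f hreal, Complex.ofReal_re]
  have eM : ∀ r : ℚ, normalizedMinusSymbol f r = (modularSymbol f r).im / minusPeriod f := fun r ↦ by
    rw [normalizedMinusSymbol, minusSymbol_eq_im_mul_I_holds f hreal, Complex.mul_im, Complex.ofReal_re, Complex.ofReal_im,
      Complex.I_re, Complex.I_im]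
    ring
  rw [Complex.sub_re, Complex.sub_im, sub_div, sub_div] at hk
  have key : ((ratPlusSymbol f x : ℚ) : ℝ) - ((ratMinusSymbol f x : ℚ) : ℝ) =
      (((ratPlusSymbol f y : ℚ) : ℝ) - ((ratMinusSymbol f y : ℚ) : ℝ)) + (k : ℝ) := by
    rw [hPx, hPy, hMx, hMy, eP, eP, eM, eM]
    linarith
  exact_mod_cast key

end Rhombic

/-! ## §2 Odd Birch without `(d, N_E) = 1` -/

section OddBirchShared

variable (W : WeierstrassCurve ℚ) [W.IsElliptic] [W.IsGloballyMinimal] {d : ℤ} {A : WeierstrassCurve ℚ} [A.IsElliptic]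
  [NeZero (W.conductorNorm ℤ)] [NeZero (A.conductorNorm ℤ)] [NeZero d.natAbs]
  {fW : CuspForm (Gamma0 (W.conductorNorm ℤ)) 2} {fA : CuspForm (Gamma0 (A.conductorNorm ℤ)) 2}

omit [A.IsElliptic] in
/-- **Birch's lemma for `(f_W, f_A)`, NEGATIVE `d`, `E` good OR multiplicative at the primes of `d`, WITH the period constant** (companion of
`exists_ratPlusSymbol_twist_eq_sum_odd_and_sq` without `(d, N_E) = 1`; tree inputs `conductorNorm_twist_dvd_sqfreeAt`,
`isNewformOf_twist_eq_charTwist_sqfreeAt`): ONE `c ∈ ℚ` with `[x]⁺_{f_A} = c·Σ_b χ_d(b)[x + b/|d|]⁻_{f_W}` for all `x`, and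
`c²·|d|·(Ω⁺_{f_A})² = (Ω⁻_{f_W})²` as soon as some `[x]⁺_{f_A} ≠ 0`. [cite: MazurTateTeitelbaum1986Invent, §I.8] [cite: Shimura1971, Prop. 3.64] -/
theorem exists_ratPlusSymbol_twist_eq_sum_odd_and_sq_sqfreeAt (hd : d < 0) (hd4 : d % 4 = 1) (hsq : Squarefree d)
    (hred : ∀ v : HeightOneSpectrum (𝓞 ℚ), ((primesEquiv v : ℕ) : ℤ) ∣ d →
      W.HasGoodReductionAt v ∨ W.HasMultiplicativeReductionAt v)
    {C : VariableChange ℚ} (hA : C • W.quadraticTwist (d : ℚ) = A) (hfW : IsNewformOf W fW) (hfA : IsNewformOf A fA)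
    {χ : MulChar (ZMod d.natAbs) ℤ} (hχ : ∀ a : ZMod d.natAbs, χ a = J((a.val : ℤ) | d.natAbs)) :
    ∃ c : ℚ, (∀ x : ℚ, ratPlusSymbol fA x =
        c * ∑ b : ZMod d.natAbs, (χ.ringHomComp (Int.castRingHom ℚ)) b * ratMinusSymbol fW (x + (b.val : ℚ) / d.natAbs)) ∧
      ((∃ x : ℚ, ratPlusSymbol fA x ≠ 0) → (c : ℝ) ^ 2 * (d.natAbs : ℝ) * plusPeriod fA ^ 2 = minusPeriod fW ^ 2) := by
  have hodd : Odd d.natAbs := Int.natAbs_odd.mpr (Int.odd_iff.mpr (by omega))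
  have hsq' : Squarefree d.natAbs := Int.squarefree_natAbs.mpr hsq
  have hm4 : d.natAbs % 4 = 3 := by omega
  obtain ⟨hq, hprim⟩ := mulChar_jacobi_complex_isQuadratic_isPrimitive hχ hodd hsq'
  have hoddχ : DirichletCharacter.Odd (χ.ringHomComp (Int.castRingHom ℂ)) := by
    show (χ.ringHomComp (Int.castRingHom ℂ)) (-1) = -1
    rw [MulChar.ringHomComp_apply, mulChar_jacobi_apply_neg_one_of_three hχ hm4, map_neg, map_one]
  have hg2 := gaussSum_stdAddChar_sq_of_isQuadratic_of_odd hprim hq hoddχ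
  obtain ⟨hN, hm, -⟩ := conductorNorm_twist_dvd_sqfreeAt W hd4 hsq hred hA
  have hFA := isNewformOf_twist_eq_charTwist_sqfreeAt W hd4 hsq hred hA hfW hfA hχ hq hprim hN hm
  subst hFA
  obtain ⟨c, hc, hper⟩ := exists_rat_forall_ratPlusSymbol_charTwist_eq_of_odd (A.conductorNorm ℤ) hN hm hq hoddχ hprim
    hfW.1 hfW.coeffField_eq_bot hfA.1 hfA.coeffField_eq_bot (fun u ↦ J((u.val : ℤ) | d.natAbs))
    (fun u ↦ by rw [MulChar.ringHomComp_apply, hχ, eq_intCast])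
  have hsum : ∀ x : ℚ, ∑ b : ZMod d.natAbs, (χ.ringHomComp (Int.castRingHom ℚ)) b *
      ratMinusSymbol fW (x + (b.val : ℚ) / d.natAbs) =
      ∑ u : ZMod d.natAbs, (J((u.val : ℤ) | d.natAbs) : ℚ) * ratMinusSymbol fW (x + twistShift u) := by
    intro x
    refine Finset.sum_congr rfl fun b _ ↦ ?_
    rw [MulChar.ringHomComp_apply, hχ, eq_intCast]
    rfl
  refine ⟨c, fun x ↦ by rw [hc x, hsum x], fun ⟨x, hx⟩ ↦ ?_⟩
  have hS : ∃ r : ℚ, ∑ u : ZMod d.natAbs, (J((u.val : ℤ) | d.natAbs) : ℚ) * ratMinusSymbol fW (r + twistShift u) ≠ 0 := by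
    refine ⟨x, fun h0 ↦ hx ?_⟩
    rw [hc x, h0, mul_zero]
  have hP := hper hS
  have hsqP := congrArg (fun z : ℂ ↦ z ^ 2) hP
  simp only [mul_pow, hg2, Complex.I_sq] at hsqP
  apply Complex.ofReal_injective
  push_cast
  linear_combination -hsqP

end OddBirchShared

/-! ## §3 The shortcut at a tame level meeting `N` in primes `ℓ ∥ N` -/

section CombinationShared

variable {N N' : ℕ} [NeZero N] [NeZero N'] (f : CuspForm (Gamma0 N) 2) (g : CuspForm (Gamma0 N') 2)
  {m : ℕ} [NeZero m]

omit [NeZero N] [NeZero N'] in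
/-- **Denominator of a tame cusp**: for `x ∈ ℚ` with `den x` prime to `m` and `b` a UNIT mod `m`, `den(x + b/m) = den(x)·m`
(the numerator `num(x)·m + b·den(x)` is prime to `den(x)` and to `m`). [folklore] -/
theorem den_add_div_eq {x : ℚ} (hxm : Nat.Coprime x.den m) {b : ZMod m} (hb : IsUnit b) :
    (x + (b.val : ℚ) / m).den = x.den * m := by
  have hm0 : (m : ℚ) ≠ 0 := by exact_mod_cast NeZero.ne m
  have hd0 : (x.den : ℚ) ≠ 0 := by exact_mod_cast x.den_nz
  obtain ⟨u, rfl⟩ := hb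
  have hbm : Nat.Coprime (u : ZMod m).val m := ZMod.val_coe_unit_coprime u
  -- `x + b/m = A/B` with `A = num·m + b·den`, `B = den·m`
  set Az : ℤ := x.num * m + ((u : ZMod m).val : ℤ) * x.den with hAz
  set Bz : ℤ := ((x.den * m : ℕ) : ℤ) with hBz
  have hq : x + ((u : ZMod m).val : ℚ) / m = (Az : ℚ) / (Bz : ℚ) := by
    have hx := Rat.num_div_den x
    rw [hAz, hBz]
    push_cast
    rw [eq_div_iff (mul_ne_zero hd0 hm0)]
    nth_rw 1 [← hx]
    field_simp
  -- coprimality of `A` and `B`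
  have h1 : IsCoprime x.num (x.den : ℤ) := by
    rw [Int.isCoprime_iff_gcd_eq_one, Int.gcd, Int.natAbs_natCast]; exact x.reduced
  have h2 : IsCoprime (m : ℤ) (x.den : ℤ) := (Nat.isCoprime_iff_coprime.mpr hxm).symm
  have h3 : IsCoprime (((u : ZMod m).val : ℤ)) (m : ℤ) := Nat.isCoprime_iff_coprime.mpr hbm
  have h4 : IsCoprime (x.den : ℤ) (m : ℤ) := Nat.isCoprime_iff_coprime.mpr hxm
  have hAden : IsCoprime Az (x.den : ℤ) := by
    have h' : IsCoprime (x.num * (m : ℤ) + (x.den : ℤ) * ((u : ZMod m).val : ℤ)) (x.den : ℤ) :=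
      (h1.mul_left h2).add_mul_left_left _
    rw [hAz]; convert h' using 2; ring
  have hAm : IsCoprime Az (m : ℤ) := by
    have h' : IsCoprime ((((u : ZMod m).val : ℤ)) * (x.den : ℤ) + (m : ℤ) * x.num) (m : ℤ) :=
      (h3.mul_left h4).add_mul_left_left _
    rw [hAz]; convert h' using 1; ring
  have hAB : IsCoprime Az Bz := by rw [hBz]; push_cast; exact hAden.mul_right hAm
  have hB0 : 0 < Bz := by
    rw [hBz]; exact_mod_cast Nat.pos_of_ne_zero (mul_ne_zero x.den_nz (NeZero.ne m))
  have hcop : Nat.Coprime Az.natAbs Bz.natAbs := by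
    have h := Int.isCoprime_iff_gcd_eq_one.mp hAB
    rwa [Int.gcd] at h
  have hden : ((((Az : ℚ) / (Bz : ℚ)).den : ℤ)) = Bz := Rat.den_div_eq_of_coprime hB0 hcop
  rw [hq]
  have : (((Az : ℚ) / (Bz : ℚ)).den : ℤ) = ((x.den * m : ℕ) : ℤ) := by rw [hden, hBz]
  exact_mod_cast this

omit [NeZero N'] in
/-- **The rhombic shortcut at a tame level meeting `N` in primes `ℓ ∥ N`, symbol level.** As
`…NegTwistSymbol.exists_int_ratPlusSymbol_twist_eq_sum_plus_add`, but `m` may share primes with `N` provided `ℓ² ∤ N` for every prime `ℓ ∣ m`: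
for every `x` with `den x` prime to `m·N`, `[x]⁺_g = c·(Σ_b χ(b)[x + b/m]⁺_f + k)` with `k ∈ ℤ` (unit `b`: the cusp `x + b/m` has denominator
`den(x)·m`, `gcd = g := gcd(m, N)`, `gcd(den, N/g) = 1`, so §1 applies with the constant `κ_g`; non-units carry `χ(b) = 0`; `Σ_b χ(b) = 0`).
[cite: MazurTateTeitelbaum1986Invent, §I.8] [cite: Manin1972, Prop. 1.4] -/
theorem exists_int_ratPlusSymbol_twist_eq_sum_plus_add_sqfreeAt (hf : IsNewform0 f) (hQ : coeffField f = ⊥) (hrh : IsRhombic f)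
    (hmN : ∀ ℓ : ℕ, ℓ.Prime → ℓ ∣ m → ¬ ℓ ^ 2 ∣ N) (χ : MulChar (ZMod m) ℤ) (hodd : χ (-1) = -1) {c : ℚ}
    (hB : ∀ x : ℚ, ratPlusSymbol g x =
      c * ∑ b : ZMod m, (χ.ringHomComp (Int.castRingHom ℚ)) b * ratMinusSymbol f (x + (b.val : ℚ) / m))
    (x : ℚ) (hx : Nat.Coprime x.den (m * N)) :
    ∃ k : ℤ, ratPlusSymbol g x =
      c * (∑ b : ZMod m, (χ.ringHomComp (Int.castRingHom ℚ)) b * ratPlusSymbol f (x + (b.val : ℚ) / m) + k) := by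
  have hxm : Nat.Coprime x.den m := Nat.Coprime.coprime_mul_right_right hx
  have hxN : Nat.Coprime x.den N := Nat.Coprime.coprime_mul_left_right hx
  set g₀ : ℕ := Nat.gcd m N with hg₀
  have hg₀N : g₀ ∣ N := Nat.gcd_dvd_right _ _
  -- `m` is prime to `N / g₀`
  have hmNg : Nat.Coprime m (N / g₀) := by
    refine Nat.coprime_of_dvd fun ℓ hℓ hℓm hℓNg ↦ ?_
    have hℓN : ℓ ∣ N := hℓNg.trans (Nat.div_dvd_of_dvd hg₀N)
    have hℓg : ℓ ∣ g₀ := Nat.dvd_gcd hℓm hℓN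
    apply hmN ℓ hℓ hℓm
    rw [sq, ← Nat.div_mul_cancel hg₀N]
    exact mul_comm ℓ ℓ ▸ Nat.mul_dvd_mul hℓNg hℓg
  set κ : ℚ := ratPlusSymbol f (1 / ((g₀ : ℕ) : ℚ)) - ratMinusSymbol f (1 / ((g₀ : ℕ) : ℚ)) with hκ
  -- per residue: `χ(b)[q]⁻ = χ(b)[q]⁺ − χ(b)κ − χ(b)k_b`
  have hkb : ∀ b : ZMod m, ∃ kb : ℤ, (χ b : ℚ) * ratMinusSymbol f (x + (b.val : ℚ) / m) =
      (χ b : ℚ) * ratPlusSymbol f (x + (b.val : ℚ) / m) - (χ b : ℚ) * κ - (χ b : ℚ) * kb := by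
    intro b
    by_cases hb : IsUnit b
    · have hden := den_add_div_eq (m := m) hxm hb
      have hgcd : Nat.gcd (x + (b.val : ℚ) / m).den N = g₀ := by
        rw [hden, hxN.gcd_mul_left_cancel m]
      have hcop : Nat.Coprime (x + (b.val : ℚ) / m).den (N / Nat.gcd (x + (b.val : ℚ) / m).den N) := by
        rw [hgcd, hden]
        exact Nat.Coprime.mul_left (hxN.coprime_dvd_right (Nat.div_dvd_of_dvd hg₀N)) hmNg
      obtain ⟨kb, hkb⟩ := exists_int_ratPlusSymbol_sub_ratMinusSymbol_eq_inv_of_isRhombic f hf hQ hrh _ hcop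
      rw [hgcd] at hkb
      exact ⟨kb, by rw [hκ]; linear_combination -(χ b : ℚ) * hkb⟩
    · refine ⟨0, ?_⟩
      rw [χ.map_nonunit hb]
      push_cast
      ring
  choose kb hkb using hkb
  have hχ1 : χ.ringHomComp (Int.castRingHom ℚ) ≠ 1 := by
    intro h1
    have h2 : (χ.ringHomComp (Int.castRingHom ℚ)) (-1) = 1 := by
      rw [h1]; exact MulChar.one_apply_coe (-1)
    rw [MulChar.ringHomComp_apply, hodd, map_neg, map_one] at h2
    norm_num at h2
  have hsum0 : ∑ b : ZMod m, (χ.ringHomComp (Int.castRingHom ℚ)) b = 0 := MulChar.sum_eq_zero_of_ne_one hχ1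
  have hsum0' : ∑ b : ZMod m, (χ b : ℚ) = 0 := by
    rw [← hsum0]
    refine Finset.sum_congr rfl fun b _ ↦ ?_
    rw [MulChar.ringHomComp_apply, eq_intCast]
  refine ⟨-∑ b : ZMod m, χ b * kb b, ?_⟩
  rw [hB x]
  congr 1
  have hterm : ∀ b : ZMod m, (χ.ringHomComp (Int.castRingHom ℚ)) b * ratMinusSymbol f (x + (b.val : ℚ) / m) =
      (χ.ringHomComp (Int.castRingHom ℚ)) b * ratPlusSymbol f (x + (b.val : ℚ) / m) - (χ b : ℚ) * κ - ((χ b * kb b : ℤ) : ℚ) := by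
    intro b
    rw [MulChar.ringHomComp_apply, eq_intCast, hkb b]
    push_cast
    ring
  rw [Finset.sum_congr rfl fun b _ ↦ hterm b, Finset.sum_sub_distrib, Finset.sum_sub_distrib, ← Finset.sum_mul, hsum0', zero_mul,
    sub_zero]
  push_cast
  ring

end CombinationShared

end Summit.BirchSwinnertonDyer.BirchSwinnertonDyer.Theorems.AlignedTransportAtTwoNegTwistSymbolShared

end
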